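import Summits.Ventures.PercRepro.RankLevelSetPlaneTen
import Summits.Ventures.PercRepro.RankLevelSetCoreGeneral

/-!
# PercRepro — the core thresholds with `f(4) ≤ 10`: `q = 4` at `32 / 16`, `q = 5` at `50 / 28`, `q = 6` at `81 / 51` (night-1, gen 3)

`RankLevelSetCoreGeneral.c025_core_four_of_flat_ten` proved C-025 at level `4` on every `e`-free core of rank
`p ≥ 32` and corank `> 15` CONDITIONALLY on `f(4) ≤ 10`; `RankLevelSetPlaneTen.ncard_le_ten_of_eRk_le_four_of_free`
is that bound. **`c025_core_four_ten`** is the composition; **`c025_core_five_twentyone`** (`f(5) ≤ 21`: rank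
`p ≥ 50`, corank `> 27`) and **`c025_core_six_fortythree`** (`f(6) ≤ 43`: rank `p ≥ 81`, corank `> 50`) run
`core_all_corank_of_thresholds_of_bound` on the sharpened flat bounds of the cover recursion. Axioms: standard.
-/

open scoped Matroid

namespace PercRepro

namespace ThmN

variable {α : Type}

/-- **The `q = 4` core threshold `32 / 16` is unconditional**: `c025_core_four_of_flat_ten` with `f(4) ≤ 10`
discharged — every `e`-free core of rank `p ≥ 32` and corank `> 15` satisfies C-025 at level `4`. -/
theorem c025_core_four_ten (M : Matroid α) [M.Finite] (p : ℕ) (hp : 32 ≤ p) (hR : M.eRank = (p : ℕ∞))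
    (hbig : p + 15 < M.E.ncard)
    (hfree : ∀ e ∈ M.E, ∃ A ⊆ M.E \ {e}, e ∉ M.closure A ∧ e ∉ M.closure ((M.E \ {e}) \ A)) : RLS M p 4 :=
  c025_core_four_of_flat_ten M p hp hR hbig hfree
    (fun _ hX hr => ncard_le_ten_of_eRk_le_four_of_free M hfree hX hr)

/-- **The core at `q = 5` with `f(4) ≤ 10`, `f(5) ≤ 21`**: rank `p ≥ 50`, `e`-free partitions, `|E| ≥ p + 28` ⇒
C-025 at `(p, 5)` (unconditional; sharpens `c025_core_five_sharpest`'s `57 / 34`). -/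
theorem c025_core_five_twentyone (M : Matroid α) [M.Finite] (p : ℕ) (hp : 50 ≤ p) (hR : M.eRank = (p : ℕ∞))
    (hbig : p + 27 < M.E.ncard)
    (hfree : ∀ e ∈ M.E, ∃ A ⊆ M.E \ {e}, e ∉ M.closure A ∧ e ∉ M.closure ((M.E \ {e}) \ A)) : RLS M p 5 := by
  have hN₁ : ∀ n, 50 ≤ n → 8 * (5 + 1) * 2 ^ (21 - 5) * n ^ 5 ≤ 2 ^ n :=
    mul_pow_le_two_pow_of_base (8 * (5 + 1) * 2 ^ (21 - 5)) 5 50 (by norm_num) (by norm_num) (by norm_num)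
  have hP₂ := threshold_II_of_base 5 (2 ^ (21 - 5)) 40 (by norm_num) (by norm_num)
  have hmax : max (max 50 40) (2 ^ 5 + 2) = 50 := by decide
  have hBj : ∀ j : ℕ, j ≤ 5 → ∀ X ⊆ M.E, M.eRk X ≤ j → X.ncard + 5 ≤ 21 + j := by
    intro j hj X hX hr
    rcases Nat.lt_or_ge j 4 with h | h
    · have := ncard_add_one_le_two_pow_of_eRk_le M (not_isLoop_of_free M hfree) hfree j X hX hr
      interval_cases j <;> omega
    · rcases Nat.lt_or_ge j 5 with h5 | h5
      · have hj4 : j = 4 := by omega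
        subst hj4
        have := ncard_le_ten_of_eRk_le_four_of_free M hfree hX hr
        omega
      · have hj5 : j = 5 := by omega
        subst hj5
        have := ncard_le_twentyone_of_eRk_le_five_of_free M hfree hX hr
        omega
  exact core_all_corank_of_thresholds_of_bound 5 21 (by norm_num) (by norm_num) 50 40 hN₁ hP₂ M p
    (by rw [hmax]; exact hp) hR (by omega) hfree hBj

/-- **The core at `q = 6` with `f(4) ≤ 10`, `f(5) ≤ 21`, `f(6) ≤ 43`**: rank `p ≥ 81`, `e`-free partitions,
`|E| ≥ p + 51` ⇒ C-025 at `(p, 6)` (the first explicit core threshold at level `6`). -/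
theorem c025_core_six_fortythree (M : Matroid α) [M.Finite] (p : ℕ) (hp : 81 ≤ p) (hR : M.eRank = (p : ℕ∞))
    (hbig : p + 50 < M.E.ncard)
    (hfree : ∀ e ∈ M.E, ∃ A ⊆ M.E \ {e}, e ∉ M.closure A ∧ e ∉ M.closure ((M.E \ {e}) \ A)) : RLS M p 6 := by
  have hN₁ : ∀ n, 81 ≤ n → 8 * (6 + 1) * 2 ^ (43 - 6) * n ^ 6 ≤ 2 ^ n :=
    mul_pow_le_two_pow_of_base (8 * (6 + 1) * 2 ^ (43 - 6)) 6 81 (by norm_num) (by norm_num) (by norm_num)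
  have hP₂ := threshold_II_of_base 6 (2 ^ (43 - 6)) 64 (by norm_num) (by norm_num)
  have hmax : max (max 81 64) (2 ^ 6 + 2) = 81 := by decide
  have hBj : ∀ j : ℕ, j ≤ 6 → ∀ X ⊆ M.E, M.eRk X ≤ j → X.ncard + 6 ≤ 43 + j := by
    intro j hj X hX hr
    rcases Nat.lt_or_ge j 4 with h | h
    · have := ncard_add_one_le_two_pow_of_eRk_le M (not_isLoop_of_free M hfree) hfree j X hX hr
      interval_cases j <;> omega
    · rcases Nat.lt_or_ge j 5 with h5 | h5
      · have hj4 : j = 4 := by omega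
        subst hj4
        have := ncard_le_ten_of_eRk_le_four_of_free M hfree hX hr
        omega
      · rcases Nat.lt_or_ge j 6 with h6 | h6
        · have hj5 : j = 5 := by omega
          subst hj5
          have := ncard_le_twentyone_of_eRk_le_five_of_free M hfree hX hr
          omega
        · have hj6 : j = 6 := by omega
          subst hj6
          have := ncard_le_fortythree_of_eRk_le_six_of_free M hfree hX hr
          omega
  exact core_all_corank_of_thresholds_of_bound 6 43 (by norm_num) (by norm_num) 81 64 hN₁ hP₂ M p
    (by rw [hmax]; exact hp) hR (by omega) hfree hBj

end ThmN

end PercRepro
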